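/-
Copyright (c) 2026 the pub-hodgecm-mathlib formalisation cell (harness21).  Prover seat hodgecm-mathlib-F0P2-p01 (g11), programme P2,
row (Tf) «FRAME TRANSPORT OF Θ-OCC-GEN's `∃ θ`-CLAUSE» of the desk's CENSUS-OCCGEN-B2 (`F0/P2/CENSUS-OCCGEN-B2.F0P2-plan-g12.md` §2 (Tf), the
OUTPUT ADAPTER of ROAD Θ-GEN-P4), 2026-09-01.  KERNEL module: THEOREMS ONLY (no definition, no named fact, no `sorry`, no instance, no notation).
-/
import Literature.NumberTheory.Automorphic.Liu2021.Def411WeilCarriersAtLineFrameTransportOfIsometry  -- ★ frame independence of `ω(μ,ε,χ)`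
import Literature.NumberTheory.Automorphic.UnitaryGroupFormCongrFinSum                      -- ★ `formCongr_mul_eq`
import Literature.NumberTheory.Automorphic.UnitaryGroupFormTransport                        -- ★ `formCongr_inv_formCongr`
import Literature.NumberTheory.Automorphic.UnitaryGroupLevelTransport                       -- ★ `coe_finAdelicCongr_apply`
import Literature.RepresentationTheory.Liu2021.OscillatorConventions                       -- ★ `isOscillatorChar_toHeckeCharacter_iff`
import HarnessLib

/-!
# FLOOR-0 P2 · (Tf) «FRAME TRANSPORT OF Θ-OCC-GEN's `∃ θ`-CLAUSE»: the clause at ONE diagonal frame `(dV′, g′, ιV′)` of `H` gives it at EVERY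
# diagonal frame `(dV, g, ιV)` of `H` (same line `a`, same `χ`, same value submodule `A`)

Cell hodgecm-mathlib (D-0151), FLOOR 0; crux item H413 = stmt-HodgeConjecture-24833 (route `HCCMUnconditional`, no route verbs); programme P2, the
OCC♭-GEN pay-down line of OCC♭∀ (`Cruxes/H413/Lines/F0_P2OccFlatGeneral.lean`, ONE letter Θ-OCC-GEN `StubThetaOccursInGen`).  Desk F0P2-plan (g12)'s
CENSUS-OCCGEN-B2 §2 ROAD Θ-GEN-P4: programme P4's ★ engine `ThetaJunction.exists_holTheta_atLine_of_inputs` produces the `∃ θ`-clause at the PIN FRAME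
`(frameD V, frameG V, ιVE V)` of the packaged hermitian space; the letter quantifies over ARBITRARY diagonal frames `(e₁, dV, hdV, hdV0, g, hg, ιV, hιV)`.
THIS FILE is the frame half (Tf) of the OUTPUT ADAPTER, in the letter's own currency and for ANY rank `N`: both frames are «pinned» in the letter's
sense (`ᵗḡ H g = diag dV`, `↑(ιV k) = g_f⁻¹ · k · g_f`), the rational ISOMETRY `B := g′⁻¹ · g` carries `diag dV′` to `diag dV`
(`formCongr_mul_eq`, `formCongr_inv_formCongr`), Liu's carrier `ω(μ, ε_a, χ)` is frame independent along `B` (★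
`exists_omegaAtLine_equiv_rhoVAtLine_of_isometry`, [Liu2021, Def. 4.11]; [GelbartRogawski1991, §3.1 Remark p. 457]), and the two transports MATCH:
`B_f · (g_f⁻¹ k g_f) · B_f⁻¹ = g′_f⁻¹ k g′_f` (`coe_finAdelicCongr_apply`) — so `θ := θ′ ∘ Ψ` is again non-zero, `A`-valued and `ρ(a,χ)`-equivariant for
right translation.  The pin frame is an instance: `ιVE V = finFrameCongr …` is pinned by ★ `coe_finFrameCongr` and `frame_congr V` is its `hg′`.
THEOREMS ONLY; `--supports stmt-HodgeConjecture-24833`.  HONEST LABEL: HC_CM is proved only modulo the printed citations until rung 0 closes; this file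
closes NO print letter.

## What is proved
* **`thetaOccursInClause_of_frame_change`** (any `N`, any `A`, any `a`, `χ`, conjugate-symplectic `μ`): pinned frames `(dV, g, ιV)`, `(dV′, g′, ιV′)` of the
  same `H`; the `∃ θ`-clause «`∃ θ : omegaAtLine[e₁, dV′] a χ →ₗ[ℂ] (U(H)(𝔸) → ℂ²), θ ≠ 0 ∧ (∀ w, θ w ∈ A) ∧ ∀ k w, θ (rhoAtLine … ιV′ a χ k w) =
  fun x ↦ θ w (x * k_𝔸)`» at `(dV′, ιV′)` implies the same clause at `(dV, ιV)`.

## References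
* [Liu2021] Y. Liu, *Fourier–Jacobi cycles and arithmetic relative trace formula*, Camb. J. Math. 9 (2021) = arXiv:2102.11518, Def. 4.11 (l. 2092–2096),
  App. D §D.1 Steps 2–3 (l. 5219–5221).
* [GelbartRogawski1991] S. Gelbart, J. Rogawski, Invent. Math. 105 (1991), §3.1 Prop. 3.1.1 p. 455; Remark p. 457 L4–13.
* [PlatonovRapinchuk1994] V. Platonov, A. Rapinchuk, *Algebraic groups and number theory* (1994), §2.3, §5.1.
-/

set_option autoImplicit false

-- the mandated namespace has the single-problem summit's repeated segment (`HodgeConjecture.HodgeConjecture`)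
set_option linter.dupNamespace false

noncomputable section

open NumberField IsDedekindDomain
open scoped Matrix ComplexOrder Classical

namespace Summit.HodgeConjecture.HodgeConjecture.Cruxes.H413.F0P2sThetaOccursInFrameTransport

open Literature.NumberTheory.Automorphic Literature.NumberTheory.Automorphic.UnitaryGroup
open Literature.NumberTheory.Automorphic.IdeleClassGroup
open Literature.NumberTheory.Automorphic.Liu2021
open Literature.NumberTheory.Automorphic.Liu2021.Def411WeilCarriers
open Literature.NumberTheory.Automorphic.Liu2021.Def411WeilCarriersDoubling
open Literature.NumberTheory.GelbartRogawski1991 Literature.NumberTheory.GelbartRogawski1991.UnitaryDualPair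
open Literature.RepresentationTheory.Liu2021
open Summit.HodgeConjecture.HodgeConjecture.Cruxes.H413

variable (L : Type) [Field L] [NumberField L] [IsCMField L] (N : ℕ) (H : Matrix (Fin N) (Fin N) L)
  {n' : ℕ} (e₁ : Fin N × Fin 1 ≃ Fin n')
  (dV : Fin N → L) (hdV : ∀ i, IsCMField.complexConj L (dV i) = dV i) (hdV0 : ∀ i, dV i ≠ 0) (g : GL (Fin N) L)
  (hg : ((g : Matrix (Fin N) (Fin N) L).map (cmConjRingHom L))ᵀ * H * (g : Matrix (Fin N) (Fin N) L) = Matrix.diagonal dV)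
  (ιV : finAdelic (↥(maximalRealSubfield L)) L (IsCMField.complexConj L) N H →*
    finAdelic (↥(maximalRealSubfield L)) L (IsCMField.complexConj L) N (Matrix.diagonal dV))
  (hιV : ∀ k, ((ιV k : finAdelic (↥(maximalRealSubfield L)) L (IsCMField.complexConj L) N (Matrix.diagonal dV)) :
        GL (Fin N) (FiniteAdeleRing (𝓞 L) L)) =
      (toFinAdeleGL L N g)⁻¹ * (k : GL (Fin N) (FiniteAdeleRing (𝓞 L) L)) * toFinAdeleGL L N g)
  (dV' : Fin N → L) (hdV' : ∀ i, IsCMField.complexConj L (dV' i) = dV' i) (hdV'0 : ∀ i, dV' i ≠ 0) (g' : GL (Fin N) L)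
  (hg' : ((g' : Matrix (Fin N) (Fin N) L).map (cmConjRingHom L))ᵀ * H * (g' : Matrix (Fin N) (Fin N) L) = Matrix.diagonal dV')
  (ιV' : finAdelic (↥(maximalRealSubfield L)) L (IsCMField.complexConj L) N H →*
    finAdelic (↥(maximalRealSubfield L)) L (IsCMField.complexConj L) N (Matrix.diagonal dV'))
  (hιV' : ∀ k, ((ιV' k : finAdelic (↥(maximalRealSubfield L)) L (IsCMField.complexConj L) N (Matrix.diagonal dV')) :
        GL (Fin N) (FiniteAdeleRing (𝓞 L) L)) =
      (toFinAdeleGL L N g')⁻¹ * (k : GL (Fin N) (FiniteAdeleRing (𝓞 L) L)) * toFinAdeleGL L N g')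
  (μ : Literature.NumberTheory.Automorphic.IdeleClassGroup L →ₜ* Circle) (hμ : IsConjugateSymplectic L μ)
  (a : (↥(maximalRealSubfield L))ˣ) (χ : Chi (↥(maximalRealSubfield L)) L (IsCMField.complexConj L))
  (A : Submodule ℂ ((adelicGroupData (↥(maximalRealSubfield L)) L (IsCMField.complexConj L) N H).Adelic → (Fin 2 → ℂ)))

include hg hg' in
/-- **The rational isometry between two diagonal frames of `H`**: `B := g′⁻¹ · g` satisfies `ᵗ(c̄B) · (diag dV′) · B = diag dV`.
[cite: PlatonovRapinchuk1994, §2.3] -/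
theorem formCongr_frameChange :
    formCongr ((IsCMField.complexConj L : L ≃ₐ[↥(maximalRealSubfield L)] L) : L →+* L) (g'⁻¹ * g)
        ((1 : L) • Matrix.diagonal dV') = Matrix.diagonal dV := by
  have hgf : formCongr ((IsCMField.complexConj L : L ≃ₐ[↥(maximalRealSubfield L)] L) : L →+* L) g H = Matrix.diagonal dV := hg
  have hgf' : formCongr ((IsCMField.complexConj L : L ≃ₐ[↥(maximalRealSubfield L)] L) : L →+* L) g' H = Matrix.diagonal dV' := hg'
  rw [one_smul, formCongr_mul_eq, ← hgf', formCongr_inv_formCongr]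
  exact hgf

include hg hg' hιV hιV' in
/-- **The two finite transports match along `B = g′⁻¹ · g`**: `B_f · (g_f⁻¹ k g_f) · B_f⁻¹ = g′_f⁻¹ k g′_f`, i.e.
`finAdelicCongr B (ιV k) = ιV′ k`. [cite: PlatonovRapinchuk1994, §5.1] -/
theorem finAdelicCongr_frameChange_apply (k : finAdelic (↥(maximalRealSubfield L)) L (IsCMField.complexConj L) N H) :
    finAdelicCongr (↥(maximalRealSubfield L)) L (IsCMField.complexConj L) (g'⁻¹ * g) one_ne_zero
        (formCongr_frameChange L N H dV g hg dV' g' hg') (ιV k) = ιV' k := by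
  apply Subtype.ext
  rw [coe_finAdelicCongr_apply, hιV k, hιV' k, map_mul, map_inv, mul_inv_rev, inv_inv]
  simp only [mul_assoc, mul_inv_cancel_left]

include hg hg' hιV hιV' in
set_option maxHeartbeats 1600000 in
/-- **(Tf) FRAME TRANSPORT OF Θ-OCC-GEN's `∃ θ`-CLAUSE.**  For two pinned diagonal frames `(dV, g, ιV)` and `(dV′, g′, ιV′)` of the same hermitian `H`
(`ᵗḡ H g = diag dV`, `↑(ιV k) = g_f⁻¹ k g_f`, and likewise primed), the same line `a`, character `χ ∈ Chi`, conjugate-symplectic `μ` and value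
submodule `A`: if the clause holds at `(dV′, ιV′)` — a NON-ZERO linear `θ′ : omegaAtLine[e₁, dV′] a χ → (U(H)(𝔸_{L⁺}) → ℂ²)` with values in `A`,
equivariant `θ′ (rhoAtLine … ιV′ a χ k w) = fun x ↦ θ′ w (x * k_𝔸)` — then it holds at `(dV, ιV)`: `θ := θ′ ∘ Ψ` for the ★ equivariant linear equivalence
`Ψ : ω[dV] ≃ ω[dV′]` along the isometry `B = g′⁻¹ g` (★ `exists_omegaAtLine_equiv_rhoVAtLine_of_isometry`; [Liu2021, Def. 4.11]: `ω(μ, ε, χ)` does not depend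
on the rational frame), whose transport `finAdelicCongr B` carries `ιV` to `ιV′`.
[cite: Liu2021, Def. 4.11 (l. 2092–2096); App. D §D.1 Steps 2–3 (l. 5219–5221)] [cite: GelbartRogawski1991, §3.1 Prop. 3.1.1 p. 455; Remark p. 457 L4–13]
[cite: PlatonovRapinchuk1994, §2.3, §5.1] -/
theorem thetaOccursInClause_of_frame_change
    (h' : ∃ θ' : omegaAtLine (↥(maximalRealSubfield L)) L (IsCMField.complexConj L) N e₁ (Matrix.diagonal dV')
          (complexConj_imagUnit L) (imagUnit_ne_zero L) (imagUnit_mul_self L) (realDiagonal_isSymm L dV' hdV')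
          (isUnit_det_realDiagonal L dV' hdV' hdV'0) (realDiagonal_map L dV' hdV').symm
          (fun b => isCompatible_chiSplittingLine L e₁ dV' hdV' hdV'0 (toHeckeCharacter L μ)
            (isUnitary_toHeckeCharacter L μ) ((isOscillatorChar_toHeckeCharacter_iff μ).mpr hμ)
            (TW (↥(maximalRealSubfield L)) b) (isSymm_TW (↥(maximalRealSubfield L)) b)
            (isUnit_det_TW (↥(maximalRealSubfield L)) b) (JW (↥(maximalRealSubfield L)) L b)
            (JW_eq (↥(maximalRealSubfield L)) L b)) a χ →ₗ[ℂ]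
        ((adelicGroupData (↥(maximalRealSubfield L)) L (IsCMField.complexConj L) N H).Adelic → (Fin 2 → ℂ)),
      θ' ≠ 0 ∧ (∀ w, θ' w ∈ A) ∧
        ∀ (k : finAdelic (↥(maximalRealSubfield L)) L (IsCMField.complexConj L) N H) (w),
          θ' (rhoAtLine (↥(maximalRealSubfield L)) L (IsCMField.complexConj L) N e₁ (Matrix.diagonal dV')
              (complexConj_imagUnit L) (imagUnit_ne_zero L) (imagUnit_mul_self L) (realDiagonal_isSymm L dV' hdV')
              (isUnit_det_realDiagonal L dV' hdV' hdV'0) (realDiagonal_map L dV' hdV').symm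
              (fun b => isCompatible_chiSplittingLine L e₁ dV' hdV' hdV'0 (toHeckeCharacter L μ)
                (isUnitary_toHeckeCharacter L μ) ((isOscillatorChar_toHeckeCharacter_iff μ).mpr hμ)
                (TW (↥(maximalRealSubfield L)) b) (isSymm_TW (↥(maximalRealSubfield L)) b)
                (isUnit_det_TW (↥(maximalRealSubfield L)) b) (JW (↥(maximalRealSubfield L)) L b)
                (JW_eq (↥(maximalRealSubfield L)) L b)) ιV' a χ k w) =
            fun x => θ' w (x * finAdelicToAdelic (↥(maximalRealSubfield L)) L (IsCMField.complexConj L) N H k)) :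
    ∃ θ : omegaAtLine (↥(maximalRealSubfield L)) L (IsCMField.complexConj L) N e₁ (Matrix.diagonal dV)
          (complexConj_imagUnit L) (imagUnit_ne_zero L) (imagUnit_mul_self L) (realDiagonal_isSymm L dV hdV)
          (isUnit_det_realDiagonal L dV hdV hdV0) (realDiagonal_map L dV hdV).symm
          (fun b => isCompatible_chiSplittingLine L e₁ dV hdV hdV0 (toHeckeCharacter L μ)
            (isUnitary_toHeckeCharacter L μ) ((isOscillatorChar_toHeckeCharacter_iff μ).mpr hμ)
            (TW (↥(maximalRealSubfield L)) b) (isSymm_TW (↥(maximalRealSubfield L)) b)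
            (isUnit_det_TW (↥(maximalRealSubfield L)) b) (JW (↥(maximalRealSubfield L)) L b)
            (JW_eq (↥(maximalRealSubfield L)) L b)) a χ →ₗ[ℂ]
        ((adelicGroupData (↥(maximalRealSubfield L)) L (IsCMField.complexConj L) N H).Adelic → (Fin 2 → ℂ)),
      θ ≠ 0 ∧ (∀ w, θ w ∈ A) ∧
        ∀ (k : finAdelic (↥(maximalRealSubfield L)) L (IsCMField.complexConj L) N H) (w),
          θ (rhoAtLine (↥(maximalRealSubfield L)) L (IsCMField.complexConj L) N e₁ (Matrix.diagonal dV)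
              (complexConj_imagUnit L) (imagUnit_ne_zero L) (imagUnit_mul_self L) (realDiagonal_isSymm L dV hdV)
              (isUnit_det_realDiagonal L dV hdV hdV0) (realDiagonal_map L dV hdV).symm
              (fun b => isCompatible_chiSplittingLine L e₁ dV hdV hdV0 (toHeckeCharacter L μ)
                (isUnitary_toHeckeCharacter L μ) ((isOscillatorChar_toHeckeCharacter_iff μ).mpr hμ)
                (TW (↥(maximalRealSubfield L)) b) (isSymm_TW (↥(maximalRealSubfield L)) b)
                (isUnit_det_TW (↥(maximalRealSubfield L)) b) (JW (↥(maximalRealSubfield L)) L b)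
                (JW_eq (↥(maximalRealSubfield L)) L b)) ιV a χ k w) =
            fun x => θ w (x * finAdelicToAdelic (↥(maximalRealSubfield L)) L (IsCMField.complexConj L) N H k) := by
  obtain ⟨θ', hne', hA', heqv'⟩ := h'
  obtain ⟨Ψ, hΨ⟩ := exists_omegaAtLine_equiv_rhoVAtLine_of_isometry L e₁ dV hdV hdV0 dV' hdV' hdV'0 (g'⁻¹ * g)
    (formCongr_frameChange L N H dV g hg dV' g' hg') (toHeckeCharacter L μ) (isUnitary_toHeckeCharacter L μ)
    ((isOscillatorChar_toHeckeCharacter_iff μ).mpr hμ) a χ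
  refine ⟨θ' ∘ₗ Ψ.toLinearMap, fun h0 => hne' ?_, fun w => hA' (Ψ w), fun k w => ?_⟩
  · -- `θ′ = (θ′ ∘ Ψ) ∘ Ψ⁻¹ = 0`
    refine LinearMap.ext fun w => ?_
    have := congrArg (fun f : _ →ₗ[ℂ] _ => f (Ψ.symm w)) h0
    simpa only [LinearMap.coe_comp, Function.comp_apply, LinearEquiv.coe_coe, LinearEquiv.apply_symm_apply,
      LinearMap.zero_apply] using this
  · -- equivariance: `ρ(a,χ)[ιV] k = ρ_V[dV] (ιV k)`, `Ψ` carries it to `ρ_V[dV′] (B_f (ιV k) B_f⁻¹) = ρ_V[dV′] (ιV′ k) = ρ(a,χ)[ιV′] k`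
    show θ' (Ψ (rhoVAtLine (↥(maximalRealSubfield L)) L (IsCMField.complexConj L) N e₁ (Matrix.diagonal dV)
        (complexConj_imagUnit L) (imagUnit_ne_zero L) (imagUnit_mul_self L) (realDiagonal_isSymm L dV hdV)
        (isUnit_det_realDiagonal L dV hdV hdV0) (realDiagonal_map L dV hdV).symm
        (fun b => isCompatible_chiSplittingLine L e₁ dV hdV hdV0 (toHeckeCharacter L μ)
          (isUnitary_toHeckeCharacter L μ) ((isOscillatorChar_toHeckeCharacter_iff μ).mpr hμ)
          (TW (↥(maximalRealSubfield L)) b) (isSymm_TW (↥(maximalRealSubfield L)) b)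
          (isUnit_det_TW (↥(maximalRealSubfield L)) b) (JW (↥(maximalRealSubfield L)) L b)
          (JW_eq (↥(maximalRealSubfield L)) L b)) a χ (ιV k) w)) =
      fun x => θ' (Ψ w) (x * finAdelicToAdelic (↥(maximalRealSubfield L)) L (IsCMField.complexConj L) N H k)
    rw [hΨ (ιV k) w, finAdelicCongr_frameChange_apply L N H dV g hg ιV hιV dV' g' hg' ιV' hιV' k]
    exact heqv' k (Ψ w)

end Summit.HodgeConjecture.HodgeConjecture.Cruxes.H413.F0P2sThetaOccursInFrameTransport

end
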